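import Summits.Ventures.CertifiedManyBodySolver.Theorems.M3x2EdgeSplitSymReplayBoxCanon
import HarnessLib

/-!
# SymReplay — ONE-CALL R-block side conditions in box form (`gramR_all_of_allB`) and in RANGE form (`gramR_all_of_rangesB`)

(pen hub-lb-sym-plan-1 g3, 2026-08-28; 30-line ADDITIVE helper on `…BoxCanon` (p636882) for the v0′ / E-class landers; to be
landed by the one writer hub-lb-sym-eng-3 if wanted.)  The closing theorems take `hRok : K.gramR.all (gramBlockROK K.frame) = true`;
`…BoxCanon` reaches it from `n` per-block facts `gramROKAtB K lo hi i = true` (`gramR_all_of_factsB`), i.e. `n` `native_decide`s,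
each re-decoding the certificate.  Here: (1) ONE fact `K.gramR.all (gramBlockROKB lo hi) = true` (one decode; v0′: 85 blocks ×
≲ 1.5 s); (2) RANGE facts `gramROKRangeB K lo hi a n = true` (blocks `a … a+n−1` in one Bool) so a lander can cut the blocks into
any number of calls (E-class), assembled by `gramROKFactsB_of_ranges`.  No summit or crux statement is proved; nothing predicts
superconductivity.
-/

namespace Summit.Ventures.CertifiedManyBodySolver.Theorems.SymReplay

/-- **(1) All R-block side conditions from ONE box fact.** -/
theorem gramR_all_of_allB (K : SymCertR) {lo hi : ℤ × ℤ} (h : boxLicence K.frame lo hi = true)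
    (hall : K.gramR.all (gramBlockROKB lo hi) = true) : K.gramR.all (gramBlockROK K.frame) = true := by
  rw [List.all_eq_true] at hall ⊢
  intro B hB
  rw [← gramBlockROKB_eq h B]
  exact hall B hB

/-- Box side conditions of the R-blocks `a, …, a+n−1` in ONE Bool (`true` past the end, like `gramROKAtB`). -/
def gramROKRangeB (K : SymCertR) (lo hi : ℤ × ℤ) (a n : ℕ) : Bool :=
  (List.range' a n).all fun i => gramROKAtB K lo hi i

/-- A range fact gives the structural per-block facts of `…BoxCanon` for that range. -/
theorem gramROKFactsB_of_range (K : SymCertR) (lo hi : ℤ × ℤ) :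
    ∀ (n a : ℕ), gramROKRangeB K lo hi a n = true → GramROKFactsB K lo hi a n := by
  intro n
  induction n with
  | zero => intro a _; exact trivial
  | succ n ih =>
    intro a h
    rw [gramROKRangeB, List.range'_succ, List.all_cons, Bool.and_eq_true] at h
    exact ⟨h.1, ih (a + 1) h.2⟩

/-- Structural facts of two adjacent ranges concatenate. -/
theorem gramROKFactsB_append (K : SymCertR) (lo hi : ℤ × ℤ) :
    ∀ (m a n : ℕ), GramROKFactsB K lo hi a m → GramROKFactsB K lo hi (a + m) n → GramROKFactsB K lo hi a (m + n) := by
  intro m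
  induction m with
  | zero => intro a n _ h; simpa using h
  | succ m ih =>
    intro a n h1 h2
    rw [show m + 1 + n = (m + n) + 1 by omega]
    exact ⟨h1.1, ih (a + 1) n h1.2 (by rwa [show a + 1 + m = a + (m + 1) by omega])⟩

/-- The range facts for consecutive ranges of sizes `ns` starting at `a` (structural on `ns`). -/
def GramROKRangesB (K : SymCertR) (lo hi : ℤ × ℤ) : ℕ → List ℕ → Prop
  | _, [] => True
  | a, n :: ns => gramROKRangeB K lo hi a n = true ∧ GramROKRangesB K lo hi (a + n) ns

/-- **(2) Range facts of sizes `ns` give the per-block facts for `ns.sum` blocks.** -/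
theorem gramROKFactsB_of_ranges (K : SymCertR) (lo hi : ℤ × ℤ) :
    ∀ (ns : List ℕ) (a : ℕ), GramROKRangesB K lo hi a ns → GramROKFactsB K lo hi a ns.sum
  | [], _, _ => trivial
  | n :: ns, a, h => by
    rw [List.sum_cons]
    exact gramROKFactsB_append K lo hi n a ns.sum (gramROKFactsB_of_range K lo hi n a h.1)
      (gramROKFactsB_of_ranges K lo hi ns (a + n) h.2)

/-- **All R-block side conditions from range facts** (`ns.sum = K.gramR.length`). -/
theorem gramR_all_of_rangesB (K : SymCertR) (lo hi : ℤ × ℤ) (h : boxLicence K.frame lo hi = true) (ns : List ℕ)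
    (hn : K.gramR.length = ns.sum) (hf : GramROKRangesB K lo hi 0 ns) : K.gramR.all (gramBlockROK K.frame) = true :=
  gramR_all_of_factsB K lo hi h ns.sum hn (gramROKFactsB_of_ranges K lo hi ns 0 hf)

/-! ##### Toy: both forms on `toyRCert` (2 R-blocks) -/

example : toyRCert.gramR.all (gramBlockROK toyRCert.frame) = true :=
  gramR_all_of_allB toyRCert (lo := minCornerP frame3) (hi := maxCornerP frame3) (by decide +kernel) (by decide +kernel)

example : toyRCert.gramR.all (gramBlockROK toyRCert.frame) = true :=
  gramR_all_of_rangesB toyRCert (minCornerP frame3) (maxCornerP frame3) (by decide +kernel) [1, 1] (by decide +kernel)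
    ⟨by decide +kernel, by decide +kernel, trivial⟩

end Summit.Ventures.CertifiedManyBodySolver.Theorems.SymReplay
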